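import Literature.NumberTheory.EllipticCurves.Kato2004.ZetaClassOnRankLeOneBranch
import Literature.NumberTheory.EllipticCurves.Kato2004.AdmissibleZetaClassPositionProofs
import HarnessLib

/-!
# Admissible Kato zeta classes are UNIQUE UP TO `Λˣ` under the uniform position of Thm. 12.5 (1)/§13.9 —
# the CROSS-WITNESS uniqueness, kernel; THEOREMS ONLY (no definition, no named fact)

Topic `NumberTheory/EllipticCurves`, sub-directory `Kato2004` (namespace = path). Cell `bsd-cm`, seat `bsd-cm-prr-ty1`
g28 (literature-prover), filed with row (GENUS-PORT-B) of crux `EllipticUnitValueSevenOfGZK` (stmt-BirchSwinnertonDyer-19945):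
block (B3) of that row pins Kato's `Ω_W`-normalised class `𝐳_{γ_W}` through the tree's UNIFORM POSITION predicate and
needs «every admissible class is a `Λˣ`-multiple of the position witness».  A sibling PROOFS file of
`Kato2004/AdmissibleZetaClass.lean`, `Kato2004/AdmissibleZetaClassPositionProofs.lean` (seat prr-ty1 g4) and
`Kato2004/ZetaClassOnRankLeOneBranch.lean` (seat prr-ty1 g27, GENUS-LIT-3).  THEOREMS ONLY: no `def`, no named fact,
no instance, no notation, no `sorry`; nothing about Kato's Main Conjecture or BSD is asserted; no summit statement is
touched.

## What is proved, and what it settles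

The AUDIT of `AdmissibleZetaClassPositionProofs.lean` (2026-08-28) recorded: the SAME-WITNESS rigidity
(`IwasawaH1Data.eq_units_smul_of_smul_eq_smul`) is kernel, but the CROSS-WITNESS statement «any two admissible classes of
the same pin `I` differ by a unit of `Λ`» is PRINT — Kato p. 230 l. 4–6 «Since `𝐇¹(V_{F_λ}(f))` is a free
`Λ[1/p]`-module of rank 1 (Thm. 12.4 (2)), this shows that `z_γ^{(p)}` is independent of the choices of `α₁, j₁, α₂, j₂,
c, d`» (elements of `𝐇¹ ⊗ ℚ` compared through their values at almost all characters; Rohrlich).  Since then the tree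
has gained the named fact ★ `exists_zetaClassPosition_of_rank_le_one` (`ZetaClassOnRankLeOneBranch.lean`): under
`rank_Λ I.H ≤ 1` there is `(z₁, k)` with `ZetaClassPosition W p K hK I k z₁` — a position that holds UNIFORMLY for EVERY
value-pinned family realised in `I.H` («`z₁ = p^k·𝐳_{γ_W}`, ONE element for all families», §13.9).  This file proves
(kernel) that the uniform position is exactly the missing bridge:

* (private) `smul_eq_smul_of_smul_position` — two positions `L • z₀ = r₀ • y`, `L • z₁ = r₁ • y` against the SAME lift `y` with
  the SAME non-zero `L` give `r₁ • z₀ = r₀ • z₁` (torsion-free module; pure algebra).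
* `AdmissibleZetaClassBody.exists_pow_smul_eq_units_smul` / `IsAdmissibleZetaClass.exists_pow_smul_eq_units_smul` — an
  admissible `z₀` and a uniform-position witness `(z₁, k)` of the same pin satisfy `p^k • z₀ = w • z₁` for a unit `w`
  of `Λ`: instantiate the UNIFORM position at the admissibility witnesses of `z₀` (same newform, embeddings, value datum,
  parameters, family, lift `y`, multiplier `M̃ ≠ 0` by `katoMultiplier_ne_zero`), compare, cancel `p^{e⁺}`.
* `IsAdmissibleZetaClass.exists_units_smul_eq_of_zetaClassPosition` — hence any two admissible classes of a pin carrying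
  a uniform-position witness differ by a unit of `Λ` (cancel `p^k` in the torsion-free `𝐇¹_Γ`); and under ★ with
  `rank_Λ I.H ≤ 1` (resp. `rank_{ℤ_p} H¹(ℤ[1/p], T_pW) ≤ 1`) this is unconditional in the witness:
  `exists_zetaClassPosition_of_rank_le_one.admissible_eq_units_smul` (`_of_rank_integralH1_le_one`).

So «the admissible set is `Λˣ·𝐳_{γ_W} ∩ I.H`» (module docstring of `AdmissibleZetaClass.lean`, «HENCE, BY PRINT») is now
a THEOREM modulo the single named fact ★ on the branch of rank `≤ 1` — the frame of every consumer in cells bsd-cm /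
bsd-potss (GZK at analytic rank `≤ 1`).

References: K. Kato, Astérisque 295 (2004): Thm. 12.4 (2) and Thm. 12.5 (1) (p. 221), §13.9 (p. 230 l. 4–9, «independent
of the choices»), Lemma 13.10 (1) (p. 230), §13.12 (p. 231) [Kato2004Asterisque]; tree: `Kato2004/AdmissibleZetaClass.lean`
(`AdmissibleZetaClassBody`, `isAdmissibleZetaClass_iff`), `Kato2004/AdmissibleZetaClassPositionProofs.lean`
(`katoMultiplier_ne_zero`, `pow_mul_ne_zero_of_ne_zero`), `Kato2004/ZetaClassOnRankLeOneBranch.lean` (`ZetaClassPositionBody`,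
`zetaClassPosition_iff`, `prime_natCast_iwasawaAlgebra`, ★), `Kato2004/IwasawaH1LambdaTorsionFreeProofs.lean`
(`IwasawaH1Data.noZeroSMulDivisors`).
-/

noncomputable section

open scoped BigOperators NumberField TensorProduct Classical
open Field IsDedekindDomain NumberField CongruenceSubgroup ValuativeRel
open Literature.NumberTheory.GaloisRepresentations
open Literature.NumberTheory.GaloisRepresentations.PeriodRingData
open Literature.NumberTheory.GaloisRepresentations.IsNonarchimedeanLocalField
open Literature.NumberTheory.PAdicHodge
open Literature.NumberTheory.EllipticCurves Literature.NumberTheory.EllipticCurves.ModularForms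
open Literature.NumberTheory.AdelicBaseChange Literature.NumberTheory.Automorphic

namespace Literature.NumberTheory.EllipticCurves.Kato2004

open EulerSystemValues Rat.HeightOneSpectrum

/-! ## §1 Two positions against the same lift (pure algebra in a torsion-free module) -/

/-- **Two positions against the same lift with the same non-zero left scalar**: in a torsion-free module over a commutative
domain, `L • z₀ = r₀ • y` and `L • z₁ = r₁ • y` with `L ≠ 0` give `r₁ • z₀ = r₀ • z₁` (both sides have `L`-multiple
`(r₀r₁) • y`). [folklore] -/
private theorem smul_eq_smul_of_smul_position {R M : Type*} [CommRing R] [IsDomain R] [AddCommGroup M] [Module R M]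
    [NoZeroSMulDivisors R M] {L r₀ r₁ : R} (hL : L ≠ 0) {z₀ z₁ y : M}
    (h₀ : L • z₀ = r₀ • y) (h₁ : L • z₁ = r₁ • y) : r₁ • z₀ = r₀ • z₁ := by
  apply smul_right_injective M hL
  dsimp only
  rw [smul_comm L r₁ z₀, h₀, smul_comm L r₀ z₁, h₁, smul_smul, smul_smul, mul_comm]

/-! ## §2 An admissible class against a uniform-position witness: `p^k • z₀ = w • z₁`, `w ∈ Λˣ` -/

section Position

variable {W : WeierstrassCurve ℚ} [W.IsElliptic] [W.IsGloballyMinimal] {p : ℕ} [Fact p.Prime]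
  [ContinuousSMul ℤ_[p] (W.tateModule p)] {K : ZpExtension ℚ p} {hK : K.IsCyclotomic}
  {γ : absoluteGaloisGroup ℚ} {I : IwasawaH1Data W p K γ}

/-- **An admissible class is `p^k` times a unit multiple of any uniform-position witness** (instance-binder form): if
`z₀` is admissible (`AdmissibleZetaClassBody`) and `(z₁, k)` is in uniform position (`ZetaClassPositionBody … k z₁`), then
`p^k • z₀ = w • z₁` for some unit `w` of `Λ`.  Proof: the uniform position, instantiated at the admissibility witnesses of
`z₀` (newform, embeddings, value datum, Kato parameters, family, lift `y`, Manin datum, Galois elements, period ratio, `e`),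
reads `(p^{(−e)⁺}M̃) • z₁ = (u₁·p^{e⁺}·p^k) • y` against `(p^{(−e)⁺}M̃) • z₀ = (u·p^{e⁺}) • y`; `M̃ ≠ 0`
(`katoMultiplier_ne_zero`) and `𝐇¹_Γ` is torsion-free, so `(u₁p^{e⁺}p^k) • z₀ = (up^{e⁺}) • z₁`, and `p^{e⁺}`, `u₁` cancel.
Kernel. [cite: Kato2004Asterisque, §13.9 (p. 230 l. 4–9, "independent of the choices"), Thm. 12.5 (1) (p. 221), Lemma 13.10 (1) (p. 230)] -/
theorem AdmissibleZetaClassBody.exists_pow_smul_eq_units_smul [Module.Free ℤ_[p] (W.tateModule p)]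
    [Module.Finite ℤ_[p] (W.tateModule p)] (hγ : K.IsTopGenerator γ) {z₀ z₁ : I.H} {k : ℕ}
    (h₀ : AdmissibleZetaClassBody W p K hK I z₀) (h₁ : ZetaClassPositionBody W p K hK I k z₁) :
    ∃ w : (IwasawaAlgebra p)ˣ, ((p : IwasawaAlgebra p) ^ k) • z₀ = (w : IwasawaAlgebra p) • z₁ := by
  obtain ⟨hp, N, hN, f, hf, ι, q, Λ, hq, hZ, c, d₁, a, A, d', hA, hc, hd, hdd', hR, z, x, hzeta, y, hy,
    qm, perRatio, e, u, n₁, n₂, n₃, n₄, σc, σd, σℓ, hqm, hspan, hs₁, hs₂, hs₃, hs₄, hσc, hσd, hσℓ, hper0, hper, he,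
    hpos⟩ := h₀
  obtain ⟨-, u₁, hu₁⟩ := h₁ hp N hN f hf ι q Λ hq hZ c d₁ a A d' hA hc hd hdd' hR z x hzeta y hy qm perRatio e
    n₁ n₂ n₃ n₄ σc σd σℓ hqm hspan hs₁ hs₂ hs₃ hs₄ hσc hσd hσℓ hper0 hper he
  haveI := I.noZeroSMulDivisors hγ
  have hL := pow_mul_ne_zero_of_ne_zero p
    (katoMultiplier_ne_zero p W hf K c d₁ a A d' hqm.ne' hs₁ hs₂ hs₃ hs₄ hR σc σd σℓ) (-e).toNat
  have key := smul_eq_smul_of_smul_position hL hpos hu₁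
  have hpe : ((p : IwasawaAlgebra p) ^ e.toNat) ≠ 0 := pow_ne_zero _ (prime_natCast_iwasawaAlgebra p).ne_zero
  have key2 : ((p : IwasawaAlgebra p) ^ e.toNat) • ((((u₁ : IwasawaAlgebra p) * (p : IwasawaAlgebra p) ^ k)) • z₀) =
      ((p : IwasawaAlgebra p) ^ e.toNat) • ((u : IwasawaAlgebra p) • z₁) := by
    rw [smul_smul, smul_smul, ← mul_comm (u : IwasawaAlgebra p), ← key]
    congr 1
    ring
  have key3 := smul_right_injective I.H hpe key2
  refine ⟨u₁⁻¹ * u, ?_⟩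
  rw [Units.val_mul, mul_smul, ← key3, smul_smul, ← mul_assoc, Units.inv_mul, one_mul]

/-- **Closed form** (any instances of the two `Prop`-valued structure facts of `T_pW`): an admissible class
`IsAdmissibleZetaClass W p K hK I z₀` and a uniform-position witness `ZetaClassPosition W p K hK I k z₁` satisfy
`p^k • z₀ = w • z₁` for a unit `w` of `Λ`. [cite: Kato2004Asterisque, §13.9 (p. 230 l. 4–9), Thm. 12.5 (1) (p. 221)] -/
theorem IsAdmissibleZetaClass.exists_pow_smul_eq_units_smul (hγ : K.IsTopGenerator γ) {z₀ z₁ : I.H} {k : ℕ}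
    (h₀ : IsAdmissibleZetaClass W p K hK I z₀) (h₁ : ZetaClassPosition W p K hK I k z₁) :
    ∃ w : (IwasawaAlgebra p)ˣ, ((p : IwasawaAlgebra p) ^ k) • z₀ = (w : IwasawaAlgebra p) • z₁ := by
  letI : Module.Free ℤ_[p] (W.tateModule p) := W.module_free_tateModule_holds p
  letI : Module.Finite ℤ_[p] (W.tateModule p) := W.module_finite_tateModule_holds p
  exact ((isAdmissibleZetaClass_iff W p K hK I z₀).mp h₀).exists_pow_smul_eq_units_smul hγ
    ((zetaClassPosition_iff k z₁).mp h₁)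

/-- **At `k = 0`**: an admissible class is a UNIT multiple of a position-`0` witness. [cite: Kato2004Asterisque, §13.9 (p. 230 l. 4–9), Thm. 12.5 (1) (p. 221)] -/
theorem IsAdmissibleZetaClass.exists_eq_units_smul_of_zetaClassPosition_zero (hγ : K.IsTopGenerator γ)
    {z₀ z₁ : I.H} (h₀ : IsAdmissibleZetaClass W p K hK I z₀) (h₁ : ZetaClassPosition W p K hK I 0 z₁) :
    ∃ w : (IwasawaAlgebra p)ˣ, z₀ = (w : IwasawaAlgebra p) • z₁ := by
  simpa only [pow_zero, one_smul] using h₀.exists_pow_smul_eq_units_smul hγ h₁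

/-! ## §3 Cross-witness uniqueness: two admissible classes differ by a unit of `Λ` -/

/-- **Two admissible classes of a pin carrying a uniform-position witness differ by a unit of `Λ`**: from
`p^k • z₀ = w • z₁` and `p^k • z₀′ = w′ • z₁`, `p^k • (z₀′) = p^k • ((w′w⁻¹) • z₀)` and `p^k ≠ 0` cancels in the torsion-free
`𝐇¹_Γ`. Kernel. [cite: Kato2004Asterisque, §13.9 (p. 230 l. 4–9, "independent of the choices"), Thm. 12.4 (2) (p. 221)] -/
theorem IsAdmissibleZetaClass.exists_units_smul_eq_of_zetaClassPosition (hγ : K.IsTopGenerator γ)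
    {z₀ z₀' z₁ : I.H} {k : ℕ} (h₀ : IsAdmissibleZetaClass W p K hK I z₀) (h₀' : IsAdmissibleZetaClass W p K hK I z₀')
    (h₁ : ZetaClassPosition W p K hK I k z₁) :
    ∃ w : (IwasawaAlgebra p)ˣ, z₀' = (w : IwasawaAlgebra p) • z₀ := by
  obtain ⟨w, hw⟩ := h₀.exists_pow_smul_eq_units_smul hγ h₁
  obtain ⟨w', hw'⟩ := h₀'.exists_pow_smul_eq_units_smul hγ h₁
  haveI := I.noZeroSMulDivisors hγ
  have hpk : ((p : IwasawaAlgebra p) ^ k) ≠ 0 := pow_ne_zero _ (prime_natCast_iwasawaAlgebra p).ne_zero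
  refine ⟨w' * w⁻¹, smul_right_injective I.H hpk ?_⟩
  dsimp only
  rw [hw', smul_comm ((p : IwasawaAlgebra p) ^ k), hw, smul_smul, Units.val_mul, mul_assoc, Units.inv_mul, mul_one]

/-- The `Λˣ`-orbit form: under a uniform-position witness, `z₀′` is admissible iff it is a unit multiple of the admissible
`z₀` (the «if» is `IsAdmissibleZetaClass.units_smul`). [cite: Kato2004Asterisque, §13.9 (p. 230 l. 4–9), Conj. 12.10 (p. 224)] -/
theorem IsAdmissibleZetaClass.iff_exists_units_smul_of_zetaClassPosition (hγ : K.IsTopGenerator γ)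
    {z₀ z₀' z₁ : I.H} {k : ℕ} (h₀ : IsAdmissibleZetaClass W p K hK I z₀) (h₁ : ZetaClassPosition W p K hK I k z₁) :
    IsAdmissibleZetaClass W p K hK I z₀' ↔ ∃ w : (IwasawaAlgebra p)ˣ, z₀' = (w : IwasawaAlgebra p) • z₀ := by
  refine ⟨fun h₀' => h₀.exists_units_smul_eq_of_zetaClassPosition hγ h₀' h₁, ?_⟩
  rintro ⟨w, rfl⟩
  exact h₀.units_smul w

end Position

/-! ## §4 Under the named fact ★ on the branch of rank `≤ 1`: admissible classes are unique up to `Λˣ` -/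

namespace exists_zetaClassPosition_of_rank_le_one

variable {W : WeierstrassCurve ℚ} [W.IsElliptic] [W.IsGloballyMinimal] {p : ℕ} [Fact p.Prime]
  [ContinuousSMul ℤ_[p] (W.tateModule p)] {κ : ZpExtension ℚ p} {γ : absoluteGaloisGroup ℚ}

/-- **Under ★ (Thm. 12.5 (1)/§13.9 on the branch) and `rank_Λ 𝐇¹_Γ ≤ 1`: any two admissible Kato zeta classes of the pin
`I` differ by a unit of `Λ`** — the cross-witness uniqueness that the audit of `AdmissibleZetaClassPositionProofs.lean`
had left as print, now kernel modulo the single named fact. [cite: Kato2004Asterisque, §13.9 (p. 230 l. 4–9, "independent of the choices"), Thm. 12.4 (2) and Thm. 12.5 (1) (p. 221)] -/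
theorem admissible_eq_units_smul (h : exists_zetaClassPosition_of_rank_le_one) (hκ : κ.IsCyclotomic)
    (hγ : κ.IsTopGenerator γ) (hp : p ≠ 2) (I : IwasawaH1Data W p κ γ)
    (hrank : Module.rank (IwasawaAlgebra p) I.H ≤ 1) {z₀ z₀' : I.H}
    (h₀ : IsAdmissibleZetaClass W p κ hκ I z₀) (h₀' : IsAdmissibleZetaClass W p κ hκ I z₀') :
    ∃ w : (IwasawaAlgebra p)ˣ, z₀' = (w : IwasawaAlgebra p) • z₀ := by
  obtain ⟨z₁, k, hpos⟩ := h W p κ γ hκ hγ hp I hrank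
  exact h₀.exists_units_smul_eq_of_zetaClassPosition hγ h₀' hpos

/-- **Base-level form** (`rank_{ℤ_p} H¹(ℤ[1/p], T_pW) ≤ 1`, e.g. Mordell–Weil rank one and `Ш(W)[p^∞]` finite).
[cite: Kato2004Asterisque, §13.9 (p. 230 l. 4–9), Thm. 12.4 (2) and Thm. 12.5 (1) (p. 221)] -/
theorem admissible_eq_units_smul_of_rank_integralH1_le_one (h : exists_zetaClassPosition_of_rank_le_one)
    (hκ : κ.IsCyclotomic) (hγ : κ.IsTopGenerator γ) (hp : p ≠ 2) (I : IwasawaH1Data W p κ γ)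
    (hrank : Module.rank ℤ_[p] (integralH1 (tateRep W p) p (κ.layerSubgroup 0)) ≤ 1) {z₀ z₀' : I.H}
    (h₀ : IsAdmissibleZetaClass W p κ hκ I z₀) (h₀' : IsAdmissibleZetaClass W p κ hκ I z₀') :
    ∃ w : (IwasawaAlgebra p)ˣ, z₀' = (w : IwasawaAlgebra p) • z₀ :=
  h.admissible_eq_units_smul hκ hγ hp I (I.rank_le_one_of_rank_integralH1_le_one hκ hγ hrank) h₀ h₀'

end exists_zetaClassPosition_of_rank_le_one

end Literature.NumberTheory.EllipticCurves.Kato2004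

end
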